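import Literature.NumberTheory.GaloisRepresentations.NumberFieldCdTwoKill
import Literature.NumberTheory.GaloisRepresentations.LocalKummerTorsion
import Literature.NumberTheory.GaloisRepresentations.BrauerTower
import Literature.NumberTheory.GaloisRepresentations.RestrictionCalculus
import Literature.NumberTheory.GaloisRepresentations.CyclicLayerSurjective
import Literature.AnabelianGeometry.AbsoluteAnabelian.GaloisCyclotomeTowerLevels
import HarnessLib

/-!
# `p`-power-torsion Brauer classes of a number field die on a layer of the cyclotomic
# `ℤ_p`-tower over `K(μ_p)` (Serre, *Cohomologie galoisienne* II §4.4 Prop. 13, dévissage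
# `μ_p ⊂ μ_{p^{m+1}} ↠ μ_p`; Tate, Cassels–Fröhlich VII §10)

Topic `NumberTheory/GaloisCohomology`; namespace `Literature.NumberTheory.GaloisCohomology`.
Proof file (theorems only: no definition, no named fact, no instance; D-0026) — node N-k
("killing") of the (F1) campaign of cell `bsd-cn100` (Poitou–Tate
`poitouTate_sum_localTatePairing_eq_zero` for THE family `LocalInvariants.canonical`, plan g12
arbitration 2026-08-26): to evaluate `∑_v inv_v` on a class of `H²(Γ_K, μ_{p^m})` one first kills
it on an open subgroup `Gal(K̄/L)` with `L/K` cyclic (then it is a cyclic class `(ψ, b)`, whose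
invariants are summed by Artin reciprocity, `BrauerSumInvCyclicClass.lean`).

The tree proves the `μ_p`-case (`exists_forall_resSub_mu_eq_zero_of_le_layerSubgroup`,
`NumberFieldCdTwoKill.lean`, Serre II §4.4 Prop. 13 with Lemme 1 and II §3.3 Prop. 9): for a number
field `K` with `p ≠ 2` or `K` totally complex, `κ` its cyclotomic `ℤ_p`-extension and `E ⊆ K̄` a
finite subextension whose Galois group fixes `μ_p`, every class of `H²(Gal(K̄/E), μ_p)` dies on every
closed `T ≤ Gal(K̄/E) ∩ κ⁻¹(p^M ℤ_p)` for some `M`.  This file extends it to `μ_{p^m}`: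

* `isSES_muInclHom_muPowHom` — the short exact sequence `0 → μ_a → μ_N → μ_b → 0`
  (`ζ ↦ ζ^a`, `N = b·a`) of discrete `Γ_k`-modules, any field `k`;
* `resSub_cohomologyMap_resModHom`, `resH_cohomologyMap_resModHom`, `resH_eq_resSub_resH` —
  restriction to (smaller) closed subgroups commutes with change of coefficients (functoriality
  bookkeeping, Mathlib `ContinuousCohomology.map`);
* `exists_forall_resSub_mu_primePow_eq_zero_of_le_layerSubgroup` — **the `μ_{p^m}` killing
  lemma, relative form**: same statement as the tree's with `μ_p` replaced by `μ_{p^m}` — by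
  induction on `m` through `0 → μ_{p^m} → μ_{p^{m+1}} → μ_p → 0` restricted to the subgroups
  `Gal(K̄/E·K_M)` (`IsSES.res`, exactness at `H²` `IsSES.exists_map_two_eq_of_map_two_eq_zero`),
  the fields `E·K_M = E ⊔ κ.layer M` being again finite over `K` with Galois group fixing `μ_p`;
* `galFixing_layer` (`Gal(K̄/K_M) = κ⁻¹(p^M ℤ_p)`), `galFixing_sup_layer`;
* `exists_resH_galFixing_sup_layer_mu_primePow_eq_zero` — **absolute form**: for every
  `c ∈ H²(Γ_K, μ_{p^m})` and every finite `E ⊆ K̄` whose Galois group fixes `μ_p` (e.g.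
  `E = K(μ_p)`; `E = K` when `p = 2`) there is `M` with `res c = 0` in
  `H²(Gal(K̄/E·K_M), μ_{p^m})`; `…_kummer`: the same for the Kummer image in `H²(·, K̄ˣ)`.

The field `E·K_M = K(μ_p)·K_M` is CYCLIC over `K` (orders `∣ p − 1` and `p^M`) and unramified
outside `p`; those two facts are recorded separately (node N-k part K3).  HONEST FRAMING:
textbook Galois cohomology (Serre CG II §4.4; Tate CF VII §10); infrastructure for Poitou–Tate;
proves no case of BSD.

## References

* J.-P. Serre, *Cohomologie galoisienne* / *Galois Cohomology* (1997), II §4.4 Prop. 13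
  (with Lemme 1), II §3.3 Prop. 9, I §2.2 (long exact sequence). [SerreGaloisCohomology1997]
* J. Tate, *Global class field theory*, Ch. VII of Cassels–Fröhlich (1967), §10 ("every element
  of `Br(K)` is split by a cyclic cyclotomic extension"). [CasselsFrohlichANT1967]
-/

noncomputable section

open CategoryTheory Function
open Field IntermediateField NumberField IsDedekindDomain

universe u

namespace Literature.NumberTheory.GaloisCohomology

open _root_.TopRep _root_.ContRepresentation _root_.ContinuousCohomology
open Literature.NumberTheory.GaloisRepresentations
open Literature.NumberTheory.GaloisRepresentations.DiscreteGaloisModule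
open Literature.NumberTheory.GaloisRepresentations.LocalWeilDatum
open Literature.NumberTheory.EllipticCurves (ZpExtension)
open Literature.AnabelianGeometry.AbsoluteAnabelian

/-! ### §1. Functoriality bookkeeping: restriction to subgroups vs change of coefficients -/

section Functoriality

variable {G : Type u} [Group G] [TopologicalSpace G] [IsTopologicalGroup G]
variable {A B : Type u} [AddCommGroup A] [TopologicalSpace A] [DiscreteTopology A]
  [AddCommGroup B] [TopologicalSpace B] [DiscreteTopology B]

/-- **Restriction to a smaller subgroup commutes with change of coefficients**:
`res_{S→T} ∘ H(f|_S) = H(f|_T) ∘ res_{S→T}` on `Hⁿ(S, A)`. [cite: SerreGaloisCohomology1997, I §2.4] -/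
theorem resSub_cohomologyMap_resModHom (ρ : ContinuousRep G ℤ A) (ρ' : ContinuousRep G ℤ B)
    (f : ρ.toTopRep ⟶ ρ'.toTopRep) {T S : Subgroup G} (h : T ≤ S) (n : ℕ)
    (z : continuousCohomology n (ρ.restrict (subgroupIncl S)).toTopRep) :
    resSub ρ' h n (cohomologyMap (resModHom S f) n z) =
      cohomologyMap (resModHom T f) n (resSub ρ h n z) := by
  -- `f` read over the inclusion `T ≤ S`: `A|_S` restricted along `T → S`, to `B|_T`
  let fh : TopRep.res ((inclHom h : T →ₜ* S) : T →* S) ((ρ.restrict (subgroupIncl S)).toTopRep) ⟶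
      (ρ'.restrict (subgroupIncl T)).toTopRep :=
    TopRep.ofHom ⟨f.hom.toContinuousLinearMap, fun t => f.hom.isIntertwining' ((t : T) : G)⟩
  have h1 : resSub ρ' h n (cohomologyMap (resModHom S f) n z) =
      ContinuousCohomology.map (inclHom h) fh n z :=
    (map_comp_apply_of (ContinuousMonoidHom.id S) (inclHom h) (inclHom h) (fun _ => rfl)
      (resIdHom (resModHom S f)) (resSubMod ρ' h) fh (fun _ => rfl) n z).symm
  have h2 : cohomologyMap (resModHom T f) n (resSub ρ h n z) =
      ContinuousCohomology.map (inclHom h) fh n z :=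
    (map_comp_apply_of (inclHom h) (ContinuousMonoidHom.id T) (inclHom h) (fun _ => rfl)
      (resSubMod ρ h) (resIdHom (resModHom T f)) fh (fun _ => rfl) n z).symm
  rw [h1, h2]

/-- **Restriction to a subgroup commutes with change of coefficients**:
`res_T ∘ H(f) = H(f|_T) ∘ res_T` on `Hⁿ(G, A)`. [cite: SerreGaloisCohomology1997, I §2.4] -/
theorem resH_cohomologyMap_resModHom (ρ : ContinuousRep G ℤ A) (ρ' : ContinuousRep G ℤ B)
    (f : ρ.toTopRep ⟶ ρ'.toTopRep) (T : Subgroup G) (n : ℕ) (z : continuousCohomology n ρ.toTopRep) :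
    resH T ρ' n (cohomologyMap f n z) = cohomologyMap (resModHom T f) n (resH T ρ n z) := by
  -- `f` read over the inclusion `T ≤ G`: `A` restricted along `T → G`, to `B|_T`
  let fT : TopRep.res ((subgroupIncl T : T →ₜ* G) : T →* G) ρ.toTopRep ⟶
      (ρ'.restrict (subgroupIncl T)).toTopRep :=
    TopRep.ofHom ⟨f.hom.toContinuousLinearMap, fun t => f.hom.isIntertwining' (t : G)⟩
  have h1 : resH T ρ' n (cohomologyMap f n z) =
      ContinuousCohomology.map (subgroupIncl T) fT n z :=
    (map_comp_apply_of (X := ρ.toTopRep) (Y := ρ'.toTopRep)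
      (Z := (ρ'.restrict (subgroupIncl T)).toTopRep)
      (ContinuousMonoidHom.id G) (subgroupIncl T) (subgroupIncl T) (fun _ => rfl)
      (resIdHom f) (𝟙 ((ρ'.restrict (subgroupIncl T)).toTopRep)) fT
      (fun _ => rfl) n z).symm
  have h2 : cohomologyMap (resModHom T f) n (resH T ρ n z) =
      ContinuousCohomology.map (subgroupIncl T) fT n z :=
    (map_comp_apply_of (X := ρ.toTopRep) (Y := (ρ.restrict (subgroupIncl T)).toTopRep)
      (Z := (ρ'.restrict (subgroupIncl T)).toTopRep)
      (subgroupIncl T) (ContinuousMonoidHom.id T) (subgroupIncl T) (fun _ => rfl)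
      (𝟙 ((ρ.restrict (subgroupIncl T)).toTopRep)) (resIdHom (resModHom T f)) fT
      (fun _ => rfl) n z).symm
  rw [h1, h2]

/-- `res_{G→T} = res_{S→T} ∘ res_{G→S}` on classes, for subgroups `T ≤ S ≤ G`.
[cite: SerreGaloisCohomology1997, I §2.4] -/
theorem resH_eq_resSub_resH (ρ : ContinuousRep G ℤ A) {S T : Subgroup G} (h : T ≤ S) (n : ℕ)
    (z : continuousCohomology n ρ.toTopRep) :
    resH T ρ n z = resSub ρ h n (resH S ρ n z) :=
  map_comp_apply_of (X := ρ.toTopRep) (Y := (ρ.restrict (subgroupIncl S)).toTopRep)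
    (Z := (ρ.restrict (subgroupIncl T)).toTopRep) (subgroupIncl S) (inclHom h) (subgroupIncl T)
    (fun _ => rfl) (𝟙 ((ρ.restrict (subgroupIncl S)).toTopRep)) (resSubMod ρ h)
    (𝟙 ((ρ.restrict (subgroupIncl T)).toTopRep)) (fun _ => rfl) n z

end Functoriality

/-! ### §2. The short exact sequence `0 → μ_a → μ_N → μ_b → 0` -/

section MuSES

variable (k : Type u) [Field k]

/-- **`0 → μ_a → μ_N → μ_b → 0` is short exact** for `N = b·a`, `a ≥ 1`: the inclusion `μ_a ⊆ μ_N`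
(`muInclHom`) followed by `ζ ↦ ζ^a : μ_N ↠ μ_b` (`muPowHom`, onto since `k̄` is algebraically closed,
`muPow_surjective`), whose kernel is `μ_a`. [cite: SerreGaloisCohomology1997, II §1.2] -/
theorem isSES_muInclHom_muPowHom {a b N : ℕ} (ha : 0 < a) (h : b * a = N) :
    IsSES (muInclHom k (Dvd.intro_left b h)) (muPowHom k N b a h) where
  comp_eq_zero := by
    ext v
    apply muVal_injective k b
    change muVal k b (muPow k N b a h (muInclusion k (Dvd.intro_left b h) v)) = muVal k b 0
    rw [muVal_muPow, muVal_muInclusion, muVal_pow_eq_one, muVal_zero]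
  injective := fun v w hvw => by
    apply muVal_injective k a
    have h' := congrArg (muVal k N) hvw
    change muVal k N (muInclusion k (Dvd.intro_left b h) v) =
      muVal k N (muInclusion k (Dvd.intro_left b h) w) at h'
    rwa [muVal_muInclusion, muVal_muInclusion] at h'
  exact_mid := fun y hy => by
    have hy' : muVal k N y ^ a = 1 := by
      have h' := congrArg (muVal k b) hy
      change muVal k b (muPow k N b a h y) = muVal k b 0 at h'
      rwa [muVal_muPow, muVal_zero] at h'
    refine ⟨muOfUnit k a (muVal k N y) hy', ?_⟩
    apply muVal_injective k N
    change muVal k N (muInclusion k (Dvd.intro_left b h) (muOfUnit k a (muVal k N y) hy')) = muVal k N y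
    rw [muVal_muInclusion, muVal_muOfUnit]
  surjective := muPow_surjective k h ha

end MuSES

/-! ### §3. The layers `K_M` of a `ℤ_p`-extension as fixing subgroups -/

section Layers

variable (K : Type) [Field K] [NumberField K] {p : ℕ} [Fact p.Prime] (κ : ZpExtension K p)

/-- **`Gal(K̄/K_M) = κ⁻¹(p^M ℤ_p)`**: the tree's `galFixing` of the layer `κ.layer M` is the layer
subgroup `κ.layerSubgroup M` (Krull correspondence, `ZpExtension.fixingSubgroup_layer`).
[cite: Washington1997, §13.1] -/
theorem galFixing_layer (M : ℕ) : galFixing K (κ.layer M) = κ.layerSubgroup M := by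
  change (κ.layer M).fixingSubgroup.comap (absoluteGaloisGroup.toAlgEquiv K).toMonoidHom = _
  rw [κ.fixingSubgroup_layer M]
  exact Subgroup.comap_map_eq_self_of_injective
    (f := (absoluteGaloisGroup.toAlgEquiv K).toMonoidHom) (absoluteGaloisGroup.toAlgEquiv K).injective _

/-- `Gal(K̄/E·K_M) = Gal(K̄/E) ∩ κ⁻¹(p^M ℤ_p)`. [cite: Washington1997, §13.1] -/
theorem galFixing_sup_layer (E : IntermediateField K (AlgebraicClosure K)) (M : ℕ) :
    galFixing K (E ⊔ κ.layer M) = galFixing K E ⊓ κ.layerSubgroup M := by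
  rw [galFixing_sup, galFixing_layer]

/-- The layers `K_M` are finite over `K` (instance-free restatement of the tree's discharge
`ZpExtension.finiteDimensional_layer_holds`). [cite: Washington1997, §13.1] -/
theorem finiteDimensional_layer' (M : ℕ) : FiniteDimensional K (κ.layer M) :=
  κ.finiteDimensional_layer_holds M

end Layers

/-! ### §4. The `μ_{p^m}` killing lemma (relative form) -/

section Kill

variable (K : Type) [Field K] [NumberField K] {p : ℕ} [hp : Fact p.Prime]

attribute [local instance] compactSpace_of_isClosed_subgroup

/-- **Classes of `H²(Gal(K̄/E), μ_{p^m})` die on `Gal(K̄/E) ∩ κ⁻¹(p^M ℤ_p)` for some `M`**, for `K`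
a number field with `p ≠ 2` or `K` totally complex, `κ` its cyclotomic `ℤ_p`-extension and `E/K`
a finite subextension of `K̄` whose Galois group fixes `μ_p` (Serre II §4.4 Prop. 13 for `μ_p`,
the tree's `exists_forall_resSub_mu_eq_zero_of_le_layerSubgroup`, extended to `μ_{p^m}` by
induction on `m` through `0 → μ_{p^m} → μ_{p^{m+1}} → μ_p → 0`): the image in `H²(μ_p)` dies on
`Gal(K̄/E·K_{M₁})`, where the class then comes from `H²(μ_{p^m})`, which dies deeper in the tower by
the induction hypothesis applied to the finite extension `E·K_{M₁}`.
[cite: SerreGaloisCohomology1997, II §4.4 Prop. 13 (with Lemme 1) and I §2.2]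
[cite: CasselsFrohlichANT1967, Ch. VII §10] -/
theorem exists_forall_resSub_mu_primePow_eq_zero_of_le_layerSubgroup
    (hk : p ≠ 2 ∨ IsTotallyComplex K) {κ : ZpExtension K p} (hκ : κ.IsCyclotomic) (m : ℕ) :
    ∀ (E : IntermediateField K (AlgebraicClosure K)) [FiniteDimensional K E],
      (∀ σ ∈ galFixing K E, ∀ ζ : rootsOfUnity p (AlgebraicClosure K),
        σ • (ζ : (AlgebraicClosure K)ˣ) = ζ) →
      ∀ y : continuousCohomology 2 ((mu K (p ^ m)).restrict (subgroupIncl (galFixing K E))).toTopRep,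
        ∃ M : ℕ, ∀ (T : Subgroup (absoluteGaloisGroup K)) (hTE : T ≤ galFixing K E)
          [IsClosed (T : Set (absoluteGaloisGroup K))], T ≤ κ.layerSubgroup M →
            resSub (mu K (p ^ m)) hTE 2 y = 0 := by
  classical
  have hpp : p.Prime := hp.out
  haveI : CompactSpace (absoluteGaloisGroup K) := absoluteGaloisGroup_compactSpace K
  induction m with
  | zero =>
    -- `μ_1` is trivial, so is every `H²(T, μ_1)`
    intro E _ _ y
    refine ⟨0, fun T hTE _ _ => ?_⟩
    have hsub : Subsingleton (MuCarrier K (p ^ 0)) := by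
      rw [pow_zero]
      change Subsingleton (Additive (rootsOfUnity 1 (AlgebraicClosure K)))
      rw [rootsOfUnity_one]
      infer_instance
    obtain ⟨c, hc⟩ := twoCocycleClass_surjective _ (resSub (mu K (p ^ 0)) hTE 2 y)
    rw [← hc, ← twoCocycleClass_zero]
    exact congrArg _ (Subtype.ext (ContinuousMap.ext fun q => Subsingleton.elim _ _))
  | succ m ih =>
    intro E _ hE y
    haveI : IsClosed ((galFixing K E : Subgroup (absoluteGaloisGroup K)) : Set (absoluteGaloisGroup K)) :=
      isClosed_galFixing K E
    -- the short exact sequence `0 → μ_{p^m} → μ_{p^{m+1}} → μ_p → 0` and its restrictions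
    have hN : p * p ^ m = p ^ (m + 1) := (pow_succ' p m).symm
    have hses := isSES_muInclHom_muPowHom K (pow_pos hpp.pos m) hN
    set f := muInclHom K (Dvd.intro_left p hN) with hf
    set g := muPowHom K (p ^ (m + 1)) p (p ^ m) hN with hg
    -- (1) the image in `H²(Gal(K̄/E), μ_p)` dies on `Gal(K̄/E) ∩ κ⁻¹(p^{M₁})`
    obtain ⟨M₁, hM₁⟩ := exists_forall_resSub_mu_eq_zero_of_le_layerSubgroup K hk hκ E hE
      (cohomologyMap (resModHom (galFixing K E) g) 2 y)
    -- the field `E₁ = E · K_{M₁}`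
    haveI : FiniteDimensional K (κ.layer M₁) := finiteDimensional_layer' K κ M₁
    let E₁ : IntermediateField K (AlgebraicClosure K) := E ⊔ κ.layer M₁
    haveI : FiniteDimensional K E₁ := IntermediateField.finiteDimensional_sup E (κ.layer M₁)
    have hE₁ : galFixing K E₁ = galFixing K E ⊓ κ.layerSubgroup M₁ := galFixing_sup_layer K κ E M₁
    have hE₁E : galFixing K E₁ ≤ galFixing K E := galFixing_antitone K le_sup_left
    have hE₁L : galFixing K E₁ ≤ κ.layerSubgroup M₁ := by rw [hE₁]; exact inf_le_right
    haveI : IsClosed ((galFixing K E₁ : Subgroup (absoluteGaloisGroup K)) : Set (absoluteGaloisGroup K)) :=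
      isClosed_galFixing K E₁
    have hE₁fix : ∀ σ ∈ galFixing K E₁, ∀ ζ : rootsOfUnity p (AlgebraicClosure K),
        σ • (ζ : (AlgebraicClosure K)ˣ) = ζ := fun σ hσ ζ => hE σ (hE₁E hσ) ζ
    -- (2) on `Gal(K̄/E₁)` the class comes from `H²(μ_{p^m})`
    set z := resSub (mu K (p ^ (m + 1))) hE₁E 2 y with hz
    have hgz : cohomologyMap (resModHom (galFixing K E₁) g) 2 z = 0 := by
      rw [hz, ← resSub_cohomologyMap_resModHom]
      exact hM₁ (galFixing K E₁) hE₁E hE₁L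
    obtain ⟨w, hw⟩ := (hses.res (galFixing K E₁)).exists_map_two_eq_of_map_two_eq_zero z hgz
    -- (3) induction hypothesis for `E₁` and `w`
    obtain ⟨M₂, hM₂⟩ := ih E₁ hE₁fix w
    refine ⟨max M₁ M₂, fun T hTE _ hT => ?_⟩
    have hT₁ : T ≤ galFixing K E₁ := by
      rw [hE₁]
      exact le_inf hTE (hT.trans (κ.layerSubgroup_antitone (le_max_left M₁ M₂)))
    have hT₂ : T ≤ κ.layerSubgroup M₂ := hT.trans (κ.layerSubgroup_antitone (le_max_right M₁ M₂))
    rw [← resSub_resSub _ hT₁ hE₁E, ← hz, ← hw, resSub_cohomologyMap_resModHom, hM₂ T hT₁ hT₂, map_zero]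

/-- **Absolute form.**  For `c ∈ H²(Γ_K, μ_{p^m})` and a finite `E ⊆ K̄` whose Galois group fixes
`μ_p` (`E = K(μ_p)`, or `E = K` if `μ_p ⊂ K`, e.g. `p = 2`), there is `M` with
`res c = 0 ∈ H²(Gal(K̄/E·K_M), μ_{p^m})`, `K_M = κ.layer M` the `M`-th layer of the cyclotomic
`ℤ_p`-extension (`p ≠ 2` or `K` totally complex).
[cite: SerreGaloisCohomology1997, II §4.4 Prop. 13] [cite: CasselsFrohlichANT1967, Ch. VII §10] -/
theorem exists_resH_galFixing_sup_layer_mu_primePow_eq_zero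
    (hk : p ≠ 2 ∨ IsTotallyComplex K) {κ : ZpExtension K p} (hκ : κ.IsCyclotomic) (m : ℕ)
    (E : IntermediateField K (AlgebraicClosure K)) [FiniteDimensional K E]
    (hE : ∀ σ ∈ galFixing K E, ∀ ζ : rootsOfUnity p (AlgebraicClosure K),
      σ • (ζ : (AlgebraicClosure K)ˣ) = ζ)
    (c : galoisCohomology (mu K (p ^ m)) 2) :
    ∃ M : ℕ, resH (galFixing K (E ⊔ κ.layer M)) (mu K (p ^ m)) 2 c = 0 := by
  haveI : CompactSpace (absoluteGaloisGroup K) := absoluteGaloisGroup_compactSpace K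
  obtain ⟨M, hM⟩ := exists_forall_resSub_mu_primePow_eq_zero_of_le_layerSubgroup K hk hκ m E hE
    (resH (galFixing K E) (mu K (p ^ m)) 2 c)
  refine ⟨M, ?_⟩
  haveI : IsClosed ((galFixing K (E ⊔ κ.layer M) : Subgroup (absoluteGaloisGroup K)) :
      Set (absoluteGaloisGroup K)) := isClosed_galFixing K _
  have hle : galFixing K (E ⊔ κ.layer M) ≤ galFixing K E := galFixing_antitone K le_sup_left
  have hlay : galFixing K (E ⊔ κ.layer M) ≤ κ.layerSubgroup M := by
    rw [galFixing_sup_layer]; exact inf_le_right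
  rw [resH_eq_resSub_resH _ hle, hM _ hle hlay]

/-- **Absolute form, Kummer images.**  With `c`, `E`, `M` as in
`exists_resH_galFixing_sup_layer_mu_primePow_eq_zero`: the Kummer image
`Kummer c ∈ H²(Γ_K, K̄ˣ) = Br(K)` also dies on `Gal(K̄/E·K_M)` — i.e. is split by the finite
extension `E·K_M` (cyclic over `K` when `E = K(μ_p)`). [cite: CasselsFrohlichANT1967, Ch. VII §10]
[cite: SerreGaloisCohomology1997, II §4.4 Prop. 13] -/
theorem exists_resH_galFixing_sup_layer_kummer_eq_zero
    (hk : p ≠ 2 ∨ IsTotallyComplex K) {κ : ZpExtension K p} (hκ : κ.IsCyclotomic) (m : ℕ)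
    (E : IntermediateField K (AlgebraicClosure K)) [FiniteDimensional K E]
    (hE : ∀ σ ∈ galFixing K E, ∀ ζ : rootsOfUnity p (AlgebraicClosure K),
      σ • (ζ : (AlgebraicClosure K)ˣ) = ζ)
    (c : galoisCohomology (mu K (p ^ m)) 2) :
    haveI : CompactSpace (absoluteGaloisGroup K) := absoluteGaloisGroup_compactSpace K
    ∃ M : ℕ, resH (galFixing K (E ⊔ κ.layer M)) (mu K (p ^ m)) 2 c = 0 ∧
      resH (galFixing K (E ⊔ κ.layer M)) (units K) 2 (cohomologyMap (kummerι K (p ^ m)) 2 c) = 0 := by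
  haveI : CompactSpace (absoluteGaloisGroup K) := absoluteGaloisGroup_compactSpace K
  obtain ⟨M, hM⟩ := exists_resH_galFixing_sup_layer_mu_primePow_eq_zero K hk hκ m E hE c
  refine ⟨M, hM, ?_⟩
  rw [resH_cohomologyMap_resModHom, hM, map_zero]

end Kill

end Literature.NumberTheory.GaloisCohomology

end
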